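import Summits.CriticalPhenomena.SAWScalingLimit.Theorems.SAWDefectDecoherenceBoundaryClosureRGateStabilityLimit
import Summits.CriticalPhenomena.SAWScalingLimit.Theorems.SAWDefectDecoherenceBoundaryClosureRGateStabilityDensity
import Summits.CriticalPhenomena.SAWScalingLimit.Theorems.SAWDefectDecoherenceBoundaryClosureRGateTraceGateBall
import Summits.CriticalPhenomena.SAWScalingLimit.Theorems.SAWDefectDecoherenceBoundaryClosureRFrameDatum
import HarnessLib

/-!
# `BoundaryClosureR` (stmt-CriticalPhenomena-14004), line `polygon-parity-squeeze`:
# stub `stub_gateStability` (GS) — Carathéodory kernel stability of the conformal gate density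

Hypothesis (GS) of the landed squeeze reduction `squeeze_of_innerPolygons`
(`Theorems/SAWDefectDecoherenceBoundaryClosureRSqueeze.lean`): for inner Dobrushin domains
`P_n ⊆ Ω` with the SAME marked points and the SAME flat pieces at both pins (radius `ρ/2` at the
normaliser `b = pt 1`, `r'` at the root `a = pt 0`) exhausting the compacts of `Ω`, frames of the
`P_n` exist whose conformal gate densities `exp((5/8)(L̄_n − L_{b,n}))` converge UNIFORMLY on the
gate segment of radius `ρ/4` to that of `Ω`.

Proof (parts I–V in the sibling files `…GateStabilityReflection/Density/Root/Kernel/Limit`):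
frames of the `P_n` exist (`Identification.frameDatum_exists`) with gate extensions `L̄_n`
(`exists_gateExtension`); the density of any frame is `exp((5/8) log(F'/F'(b)))` for the Schwarz
reflection `F` of the frame across the gate (parts I–II), so it suffices that
`F_n'/F_n'(b) → F'/F'(b)` uniformly on the gate segment.  The normalised reflections
`F_n/F_n'(b)` form a normal family on the gate disc (Koebe), and EVERY subsequential limit is
`F/F'(b)` (part V: kernel argument with the inverse frames, surjectivity by local Montel limits,
divergence at the pinned root by Koebe, uniqueness of frames up to dilation); hence the whole
sequence converges locally uniformly (`gateRatio_tendstoLocallyUniformlyOn`), so do the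
derivatives, and the `5/8`-powers follow by uniform continuity (part II).

References: Pommerenke, *Boundary Behaviour of Conformal Maps* (1992), Thm. 1.8 (Carathéodory
kernel theorem); Duminil-Copin–Smirnov, Ann. of Math. 175 (2012), Conjecture 2.
-/

noncomputable section

open scoped Topology
open Filter Set Metric Complex Bornology Function
open UpperHalfPlane (upperHalfPlaneSet isOpen_upperHalfPlaneSet)
open Literature.Probability.RandomPlanarGeometry
open Summit.CriticalPhenomena.SAWScalingLimit.Theorems.PickHalfPlane

namespace Summit.CriticalPhenomena.SAWScalingLimit.Theorems.PolygonParitySqueeze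

namespace GateStability

/-! ### 1. Convergence of the normalised gate reflections (normality + identification) -/

/-- **The normalised gate reflections of the inner frames converge to that of `Ω`.** In the
setting of `kernel_limit_eq` (part V), `F_n / F_n'(b) → F / F'(b)` locally uniformly on the gate
disc `B(b, R₁)`: the family is normal (`gateFamily_locallyBounded` + Montel) and every
subsequential limit is `F/F'(b)` (`kernel_limit_eq`), so a compact set with a bad subsequence would
carry a further subsequence converging uniformly to `F/F'(b)`, a contradiction.
[cite: PommerenkeBBCM1992, Thm. 1.8] -/
theorem gateRatio_tendstoLocallyUniformlyOn (D : DobrushinDomain) {R₁ R₀ : ℝ} (hR₁ : 0 < R₁)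
    (hR₀ : 0 < R₀)
    (hflat1 : D.carrier ∩ ball (D.pt 1) R₁ = {z : ℂ | (D.pt 1).im < z.im} ∩ ball (D.pt 1) R₁)
    (hflat0 : D.carrier ∩ ball (D.pt 0) R₀ = {z : ℂ | (D.pt 0).im < z.im} ∩ ball (D.pt 0) R₀)
    (Φ : ConformalEquiv D.carrier upperHalfPlaneSet)
    (hΦ0 : Tendsto (fun z => ‖Φ z‖) (𝓝[D.carrier] (D.pt 0)) atTop)
    (hΦ1 : Φ.HasBoundaryValue (D.pt 1) 0)
    {F : ℂ → ℂ} (hFd : DifferentiableOn ℂ F (ball (D.pt 1) R₁))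
    (hFΦ : EqOn F Φ (D.carrier ∩ ball (D.pt 1) R₁)) (hFc : deriv F (D.pt 1) ≠ 0)
    (P : ℕ → DobrushinDomain) (hPsub : ∀ n, (P n).carrier ⊆ D.carrier)
    (hPflat1 : ∀ n, (P n).carrier ∩ ball (D.pt 1) R₁ = {z : ℂ | (D.pt 1).im < z.im} ∩ ball (D.pt 1) R₁)
    (hPflat0 : ∀ n, (P n).carrier ∩ ball (D.pt 0) R₀ = {z : ℂ | (D.pt 0).im < z.im} ∩ ball (D.pt 0) R₀)
    (hK1 : ∀ K : Set ℂ, IsCompact K → K ⊆ D.carrier → ∀ᶠ n in atTop, K ⊆ (P n).carrier)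
    (ΦP : ∀ n, ConformalEquiv (P n).carrier upperHalfPlaneSet)
    {FP : ℕ → ℂ → ℂ} (hFPd : ∀ n, DifferentiableOn ℂ (FP n) (ball (D.pt 1) R₁))
    (hFPinj : ∀ n, InjOn (FP n) (ball (D.pt 1) R₁))
    (hFPΦ : ∀ n, EqOn (FP n) (ΦP n) ((P n).carrier ∩ ball (D.pt 1) R₁))
    (hFPb : ∀ n, FP n (D.pt 1) = 0)
    (hcP : ∀ n, 0 < (deriv (FP n) (D.pt 1)).re ∧ (deriv (FP n) (D.pt 1)).im = 0)
    {hP : ℕ → ℂ → ℂ} (hhPd : ∀ n, DifferentiableOn ℂ (hP n) (ball (D.pt 0) R₀))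
    (hhPinj : ∀ n, InjOn (hP n) (ball (D.pt 0) R₀)) (hhP0 : ∀ n, hP n (D.pt 0) = 0)
    (hhPΦ : ∀ n, ∀ z ∈ (P n).carrier ∩ ball (D.pt 0) R₀, hP n z * ΦP n z = 1) :
    TendstoLocallyUniformlyOn (fun n z => FP n z / deriv (FP n) (D.pt 1))
      (fun z => F z / deriv F (D.pt 1)) atTop (ball (D.pt 1) R₁) := by
  set b : ℂ := D.pt 1 with hbdef
  rw [tendstoLocallyUniformlyOn_iff_forall_isCompact isOpen_ball]
  intro K hKB hK
  by_contra hnotK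
  rw [Metric.tendstoUniformlyOn_iff] at hnotK
  push Not at hnotK
  obtain ⟨ε, hε, hfreq⟩ := hnotK
  obtain ⟨m, hm, hbad⟩ := Filter.extraction_of_frequently_atTop hfreq
  -- normality along the bad subsequence
  obtain ⟨Gl, κ, hκ, -, hGl, -⟩ := Complex.exists_strictMono_tendstoLocallyUniformlyOn_deriv
    isOpen_ball (F := fun k z => FP (m k) z / deriv (FP (m k)) b)
    (fun k => (hFPd (m k)).div_const _)
    (gateFamily_locallyBounded hR₁ (fun k => hFPd (m k)) (fun k => hFPinj (m k))
      (fun k => hFPb (m k)))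
  -- identification of the limit
  have hEq := kernel_limit_eq D hR₁ hR₀ hflat1 hflat0 Φ hΦ0 hΦ1 hFd hFΦ hFc P hPsub hPflat1 hPflat0
    hK1 ΦP hFPd hFPinj hFPΦ hFPb hcP hhPd hhPinj hhP0 hhPΦ (hm.comp hκ) hGl
  have hunif := (tendstoLocallyUniformlyOn_iff_forall_isCompact isOpen_ball).1
    (hGl.congr_right hEq) K hKB hK
  obtain ⟨k, hk⟩ := ((Metric.tendstoUniformlyOn_iff.1 hunif) ε hε).exists
  obtain ⟨x, hxK, hx⟩ := hbad (κ k)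
  exact absurd (hk x hxK) (not_lt.2 hx)

/-! ### 2. Bounds for the limit ratio on the compact gate segment -/

/-- On the closed gate segment of radius `R₁/2` the ratio `F'/F'(b)` (real positive along the
diameter) is pinched between two positive constants. [folklore] -/
theorem gateRatio_bounds {b : ℂ} {R₁ : ℝ} (hR₁ : 0 < R₁) {F : ℂ → ℂ}
    (hFd : DifferentiableOn ℂ F (ball b R₁))
    (hpos : ∀ z ∈ ball b R₁, z.im = b.im → 0 < (deriv F z).re ∧ (deriv F z).im = 0) :
    ∃ μ M : ℝ, 0 < μ ∧ ∀ x ∈ {z : ℂ | z.im = b.im} ∩ ball b (R₁ / 2),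
      μ ≤ (deriv F x / deriv F b).re ∧ (deriv F x / deriv F b).re ≤ M ∧
        (deriv F x / deriv F b).im = 0 := by
  set K : Set ℂ := closedBall b (R₁ / 2) ∩ {z : ℂ | z.im = b.im} with hKdef
  have hKc : IsCompact K := (isCompact_closedBall _ _).inter_right (isClosed_eq continuous_im continuous_const)
  have hKB : K ⊆ ball b R₁ := inter_subset_left.trans (closedBall_subset_ball (by linarith))
  have hbK : b ∈ K := ⟨mem_closedBall_self (by positivity), rfl⟩
  have hreal : ∀ z ∈ K, deriv F z = ((deriv F z).re : ℂ) := fun z hz =>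
    Complex.ext (by simp) (by simp [(hpos z (hKB hz) hz.2).2])
  have hb0 : (deriv F b).re ≠ 0 := (hpos b (hKB hbK) rfl).1.ne'
  have hquot : ∀ z ∈ K, deriv F z / deriv F b = (((deriv F z).re / (deriv F b).re : ℝ) : ℂ) :=
    fun z hz => by rw [ofReal_div, ← hreal z hz, ← hreal b hbK]
  have hcont : ContinuousOn (fun z => (deriv F z / deriv F b).re) K :=
    (continuous_re.comp_continuousOn
      (((hFd.analyticOnNhd isOpen_ball).deriv.continuousOn.mono hKB).div_const _))
  obtain ⟨zm, hzm, hmin⟩ := hKc.exists_isMinOn ⟨b, hbK⟩ hcont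
  obtain ⟨zM, hzM, hmax⟩ := hKc.exists_isMaxOn ⟨b, hbK⟩ hcont
  refine ⟨(deriv F zm / deriv F b).re, (deriv F zM / deriv F b).re, ?_, fun x hx => ?_⟩
  · rw [hquot zm hzm, ofReal_re]
    exact div_pos (hpos zm (hKB hzm) hzm.2).1 (hpos b (hKB hbK) rfl).1
  · have hxK : x ∈ K := ⟨ball_subset_closedBall hx.2, hx.1⟩
    exact ⟨hmin hxK, hmax hxK, by rw [hquot x hxK, ofReal_im]⟩

end GateStability

open GateStability

/-! ### 3. The registered stub -/

/-- **Stub `stub_gateStability` (GS) of the line `polygon-parity-squeeze`** (crux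
`BoundaryClosureR`, stmt-CriticalPhenomena-14004): Carathéodory kernel stability of the conformal
gate density for inner domains pinned at both marked points — see the module docstring.
[cite: PommerenkeBBCM1992, Thm. 1.8 (Carathéodory kernel theorem)] -/
theorem stub_gateStability : (∀ (D : DobrushinDomain) (ρ r₀ r' : ℝ), 0 < ρ → 0 < r' → r' ≤ r₀ → D.carrier ∩ Metric.ball (D.pt 1) ρ = {z : ℂ | (D.pt 1).im < z.im} ∩ Metric.ball (D.pt 1) ρ → D.carrier ∩ Metric.ball (D.pt 0) r₀ = {z : ℂ | (D.pt 0).im < z.im} ∩ Metric.ball (D.pt 0) r₀ → 2 * ρ < dist (D.pt 0) (D.pt 1) → ∀ (Φ : ConformalEquiv D.carrier UpperHalfPlane.upperHalfPlaneSet) (L : ℂ → ℂ) (Lb : ℂ), ConformalFrame D Φ L Lb → ∀ (Lbar : ℂ → ℂ), ContinuousOn Lbar (D.carrier ∪ gateSeg D ρ) → EqOn Lbar L D.carrier → ∀ (P : ℕ → DobrushinDomain), (∀ n, (P n).pt 0 = D.pt 0 ∧ (P n).pt 1 = D.pt 1 ∧ (P n).carrier ⊆ D.carrier ∧ (P n).carrier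 ∩ Metric.ball (D.pt 1) (ρ / 2) = {z : ℂ | (D.pt 1).im < z.im} ∩ Metric.ball (D.pt 1) (ρ / 2) ∧ (P n).carrier ∩ Metric.ball (D.pt 0) r' = {z : ℂ | (D.pt 0).im < z.im} ∩ Metric.ball (D.pt 0) r') → (∀ K : Set ℂ, IsCompact K → K ⊆ D.carrier → ∀ᶠ n : ℕ in atTop, K ⊆ (P n).carrier) → ∃ (ΦP : (n : ℕ) → ConformalEquiv (P n).carrier UpperHalfPlane.upperHalfPlaneSet) (LP : ℕ → ℂ → ℂ) (LbP : ℕ → ℂ) (LbarP : ℕ → ℂ → ℂ), (∀ n, ConformalFrame (P n) (ΦP n) (LP n) (LbP n) ∧ ContinuousOn (LbarP n) ((P n).carrier ∪ gateSeg (P n) (ρ / 2)) ∧ EqOn (LbarP n) (LP n) (P n).carrier) ∧ TendstoUniformlyOn (fun n x => Complex.exp ((5 / 8 : ℂ) * (LbarP n x - LbP n))) (fun x => Complex.exp ((5 / 8 : ℂ) * (Lbar x - Lb))) atTop (gateSeg D (ρ / 4))) := by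
  intro D ρ r₀ r' hρ hr' hr'r₀ hflatρ hflatr₀ hdist Φ L Lb hfr Lbar hLbar hLbarL P hP hK1
  set b : ℂ := D.pt 1 with hbdef
  set a : ℂ := D.pt 0 with hadef
  have hP0 : ∀ n, (P n).pt 0 = a := fun n => (hP n).1
  have hP1 : ∀ n, (P n).pt 1 = b := fun n => (hP n).2.1
  have hPsub : ∀ n, (P n).carrier ⊆ D.carrier := fun n => (hP n).2.2.1
  -- radii
  set R₀ : ℝ := min r' ρ with hR₀def
  have hR₁ : 0 < ρ / 2 := by positivity
  have hR₀ : 0 < R₀ := lt_min hr' hρ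
  have ha1 : a ∉ ball b (ρ / 2) := fun h => by
    have := mem_ball.1 h; linarith
  have hb0 : b ∉ ball a R₀ := fun h => by
    have := mem_ball.1 h; rw [dist_comm] at this; linarith [min_le_right r' ρ]
  -- flat pieces at the reduced radii
  have hflat1 : D.carrier ∩ ball b (ρ / 2) = {z : ℂ | b.im < z.im} ∩ ball b (ρ / 2) :=
    Engine.flat_of_subset hflatρ rfl (ball_subset_ball (by linarith))
  have hflat0 : D.carrier ∩ ball a R₀ = {z : ℂ | a.im < z.im} ∩ ball a R₀ :=
    Engine.flat_of_subset hflatr₀ rfl (ball_subset_ball ((min_le_left r' ρ).trans hr'r₀))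
  have hPflat1 : ∀ n, (P n).carrier ∩ ball b (ρ / 2) = {z : ℂ | b.im < z.im} ∩ ball b (ρ / 2) :=
    fun n => (hP n).2.2.2.1
  have hPflat0 : ∀ n, (P n).carrier ∩ ball a R₀ = {z : ℂ | a.im < z.im} ∩ ball a R₀ := fun n =>
    Engine.flat_of_subset (hP n).2.2.2.2 rfl (ball_subset_ball (min_le_left r' ρ))
  have hPflat1' : ∀ n, (P n).carrier ∩ ball ((P n).pt 1) (ρ / 2) =
      {z : ℂ | ((P n).pt 1).im < z.im} ∩ ball ((P n).pt 1) (ρ / 2) := fun n => by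
    rw [hP1 n]; exact hPflat1 n
  have hPflat0' : ∀ n, (P n).carrier ∩ ball ((P n).pt 0) R₀ =
      {z : ℂ | ((P n).pt 0).im < z.im} ∩ ball ((P n).pt 0) R₀ := fun n => by
    rw [hP0 n]; exact hPflat0 n
  have ha1' : ∀ n, (P n).pt 0 ∉ ball ((P n).pt 1) (ρ / 2) := fun n => by
    rw [hP0 n, hP1 n]; exact ha1
  have hb0' : ∀ n, (P n).pt 1 ∉ ball ((P n).pt 0) R₀ := fun n => by
    rw [hP0 n, hP1 n]; exact hb0
  have hρd : ∀ n, ρ / 2 ≤ dist ((P n).pt 0) ((P n).pt 1) := fun n => by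
    rw [hP0 n, hP1 n]; linarith
  -- frames of the inner domains, their gate extensions and their reflections
  choose ΦP LP LbP hfrP using fun n =>
    Identification.frameDatum_exists (P n) (ρ / 2) hR₁ (hPflat1' n)
  choose LbarP hLbarPc hLbarPL using fun n =>
    exists_gateExtension (P n) (hPflat1' n) (hρd n) (ΦP n) (LP n) (hfrP n).1 (hfrP n).2.2.1
      (hfrP n).2.2.2.1
  choose FP hFPd hFPinj hFPΦ hFPb hFPreal hFPpos using fun n =>
    exists_gateReflection (P n) hR₁ (hPflat1' n) (ha1' n) (ΦP n) (hfrP n).1 (hfrP n).2.1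
  choose hP' hhPd hhPinj hhP0 hhPΦ using fun n =>
    exists_rootReflection (P n) hR₀ (hPflat0' n) (hb0' n) (ΦP n) (hfrP n).1 (hfrP n).2.1
  obtain ⟨F, hFd, hFinj, hFΦ, hFb, -, hFpos⟩ :=
    exists_gateReflection D hR₁ hflat1 ha1 Φ hfr.1 hfr.2.1
  have hFc : deriv F b ≠ 0 := fun h => by
    have := (hFpos b (mem_ball_self hR₁) rfl).1; rw [h, zero_re] at this; exact lt_irrefl _ this
  -- convergence of the normalised reflections and of their derivatives
  have hA := gateRatio_tendstoLocallyUniformlyOn D hR₁ hR₀ hflat1 hflat0 Φ hfr.1 hfr.2.1 hFd hFΦ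
    hFc P hPsub hPflat1 hPflat0 hK1 ΦP
    (fun n => by have := hFPd n; rwa [hP1 n] at this)
    (fun n => by have := hFPinj n; rwa [hP1 n] at this)
    (fun n => by have := hFPΦ n; rwa [hP1 n] at this)
    (fun n => by have := hFPb n; rwa [hP1 n] at this)
    (fun n => by have := hFPpos n ((P n).pt 1) (mem_ball_self hR₁) rfl; rwa [hP1 n] at this)
    (fun n => by have := hhPd n; rwa [hP0 n] at this)
    (fun n => by have := hhPinj n; rwa [hP0 n] at this)
    (fun n => by have := hhP0 n; rwa [hP0 n] at this)
    (fun n => by have := hhPΦ n; rwa [hP0 n] at this)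
  have hAd : TendstoLocallyUniformlyOn (fun n z => deriv (FP n) z / deriv (FP n) b)
      (fun z => deriv F z / deriv F b) atTop (ball b (ρ / 2)) := by
    have h := hA.deriv (Eventually.of_forall fun n =>
      (show DifferentiableOn ℂ (FP n) (ball b (ρ / 2)) from by
        have := hFPd n; rwa [hP1 n] at this).div_const _) isOpen_ball
    refine (h.congr fun n z _ => ?_).congr_right fun z _ => ?_
    · simp only [Function.comp_apply, deriv_div_const, hbdef]
    · simp only [deriv_div_const, hbdef]
  have hunif : TendstoUniformlyOn (fun n z => deriv (FP n) z / deriv (FP n) b)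
      (fun z => deriv F z / deriv F b) atTop (gateSeg D (ρ / 4)) :=
    ((tendstoLocallyUniformlyOn_iff_forall_isCompact isOpen_ball).1 hAd (closedBall b (ρ / 4))
      (closedBall_subset_ball (by linarith)) (isCompact_closedBall _ _)).mono
      (inter_subset_right.trans ball_subset_closedBall)
  -- the `5/8`-powers
  obtain ⟨μ, M, hμ, hbd⟩ := gateRatio_bounds hR₁ hFd hFpos
  have hexp := tendstoUniformlyOn_cexp_mul_clog (K := gateSeg D (ρ / 4)) hμ (fun x hx => hbd x
    ⟨hx.1, by have := hx.2; rw [show ρ / 2 / 2 = ρ / 4 by ring]; exact this⟩) hunif (5 / 8 : ℂ)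
  -- the densities through the reflected frames
  have hdensP : ∀ n, ∀ x ∈ gateSeg D (ρ / 4), LbarP n x - LbP n =
      Complex.log (deriv (FP n) x / deriv (FP n) b) := by
    intro n x hx
    have h := gateDensity_eq (P n) hR₁ (hPflat1' n) (hfrP n).2.2.2.1 (hfrP n).2.2.2.2 (hLbarPc n)
      (hLbarPL n) (hFPd n) (hFPΦ n) (hFPpos n) x (by
        refine ⟨by rw [hP1 n]; exact hx.1, ?_⟩
        rw [hP1 n]; exact ball_subset_ball (by linarith) hx.2)
    rwa [hP1 n] at h
  have hdens : ∀ x ∈ gateSeg D (ρ / 4), Lbar x - Lb = Complex.log (deriv F x / deriv F b) := by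
    intro x hx
    have hsub : D.carrier ∪ gateSeg D (ρ / 2) ⊆ D.carrier ∪ gateSeg D ρ :=
      union_subset_union_right _ (inter_subset_inter_right _ (ball_subset_ball (by linarith)))
    exact gateDensity_eq D hR₁ hflat1 hfr.2.2.2.1 hfr.2.2.2.2 (hLbar.mono hsub) hLbarL hFd hFΦ
      hFpos x ⟨hx.1, ball_subset_ball (by linarith) hx.2⟩
  refine ⟨ΦP, LP, LbP, LbarP, fun n => ⟨hfrP n, hLbarPc n, hLbarPL n⟩, ?_⟩
  refine (hexp.congr (Eventually.of_forall fun n x hx => ?_)).congr_right fun x hx => ?_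
  · show Complex.exp (5 / 8 * Complex.log (deriv (FP n) x / deriv (FP n) b)) =
      Complex.exp (5 / 8 * (LbarP n x - LbP n))
    rw [hdensP n x hx]
  · show Complex.exp (5 / 8 * Complex.log (deriv F x / deriv F b)) =
      Complex.exp (5 / 8 * (Lbar x - Lb))
    rw [hdens x hx]

end Summit.CriticalPhenomena.SAWScalingLimit.Theorems.PolygonParitySqueeze

end
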